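import Mathlib
import Literature.Computability.Complexity.GraphEncodings
import Literature.Computability.Complexity.SymmetricCircuit
import Literature.Computability.Complexity.FoldCatBricks
import Literature.Computability.Complexity.UnaryOffsets
import Literature.Computability.Complexity.UnaryBricks
import Literature.Computability.Complexity.FPStringBricks
import Literature.Computability.Complexity.PlumbingBricks
import Literature.Computability.Complexity.Classes
import Literature.Computability.Complexity.SparseSetsUpwardSeparationNE
import Literature.Computability.Complexity.KarpChromaticMachine
import Summits.PneNP.PneNP.Theorems.SymmetryBudgetWindowBarrierRankDict
import Summits.PneNP.PneNP.Theorems.SymmetryBudgetWindowBarrierExtractBricks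
import Summits.PneNP.PneNP.Theorems.SymmetryBudgetWindowBarrierExtractBricks2

/-!
# Graph bridge for stub `stub_completeInvariantFP_of_canonicalForm` (line `canonical-form-completeness`,
crux `SymmetryBudget.WindowBarrier`, item stmt-PneNP-2145)

The values of the extraction bricks (`SymmetryBudgetWindowBarrierExtractBricks{,2}.lean`) on the code
`encodingGraph.encode ⟨m, G⟩ = ⟨encodeNat m, A⟩` of an `m`-vertex simple graph, in graph language.
With `g = ⌊log₂ m⌋` FREE vertices `fre j = n + j` and `n = m - g` ORDERED vertices `org i = i`:

* adjacency bits and their windows (`getD_adjOf`, `window_adjOf`): `A[u m + v] = [G.Adj u v]`;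
* `attOf (code G) t = [G.Adj (fre t) (org 0), …, G.Adj (fre t) (org (n-1))]` (`attOf_code`);
* `fixedFn` separates exactly the ordered × ordered blocks (`fixedFn_code_eq_iff`);
* `freeFn (code G)` is the adjacency code of the induced free graph `freeG G = G.comap fre`
  (`KarpChromatic.ccat_eq_flatten_ofFn`, `List.ofFn_mul`), and
  **`extractFn (code G) = ⟨encodingGraph.encode ⟨g, freeG G⟩, (encodingFinVec encodingNatBool g).encode rk⟩`**
  with `rk j = rankFam (attOf (code G)) g j` — literally the input format of the canonical-form hypothesis;
* `dictFn (code G) = encList [lookupFam (attOf (code G)) g n r | r < g]`;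
* the two halves of the isomorphism bookkeeping: a `ρ ∈ pointStabiliserBudget m g` carrying `G₁` onto `G₂`
  restricts to a permutation `σ` of the free block (`exists_freePerm`), and a permutation of the free block
  that preserves attachment vectors and the free graph extends by the identity to such a `ρ`
  (`exists_budget_perm`, via `Equiv.Perm.extendDomain`).
-/

-- `Summit.PneNP.PneNP.…` duplicates `PneNP` BY DESIGN (single-problem summit).
set_option linter.dupNamespace false

namespace Summit.PneNP.PneNP.Theorems.CompleteInvariant

open Literature.Computability.Complexity Brick Plumb UnaryOffsets
open _root_.Computability Polynomial
open scoped Classical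

/-! ### Adjacency codes -/

variable {m : ℕ}

/-- The adjacency string of `G` (row-major, `m²` bits). -/
noncomputable abbrev adjOf (G : SimpleGraph (Fin m)) : List Bool := (encodingGraphFin m).encode G

/-- The code of `⟨m, G⟩`. -/
noncomputable abbrev codeOf (G : SimpleGraph (Fin m)) : List Bool := encodingGraph.encode ⟨m, G⟩

/-- The adjacency string, unfolded. -/
theorem adjOf_eq (G : SimpleGraph (Fin m)) :
    adjOf G = List.ofFn fun k : Fin (m * m) => decide (G.Adj k.divNat k.modNat) := by
  simp [adjOf, encodingGraphFin, encodingBitVec]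

/-- `|adjOf G| = m²`. -/
@[simp] theorem length_adjOf (G : SimpleGraph (Fin m)) : (adjOf G).length = m * m := by
  rw [adjOf_eq, List.length_ofFn]

/-- The code is the pair of `encodeNat m` and the adjacency string. -/
theorem codeOf_eq (G : SimpleGraph (Fin m)) : codeOf G = boolPair (encodeNat m) (adjOf G) := rfl

/-- **Adjacency bits**: `A[u m + v] = [G.Adj u v]`. -/
theorem getD_adjOf (G : SimpleGraph (Fin m)) (u v : Fin m) :
    (adjOf G).getD (u * m + v) false = decide (G.Adj u v) := by
  have hlt : (u : ℕ) * m + v < m * m := by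
    have hu := u.2; have hv := v.2
    calc (u : ℕ) * m + v < u * m + m := by omega
      _ = (u + 1) * m := by ring
      _ ≤ m * m := Nat.mul_le_mul_right m hu
  rw [adjOf_eq, List.getD_eq_getElem?_getD, List.getElem?_eq_getElem (by simpa using hlt), Option.getD_some,
    List.getElem_ofFn]
  have hm : 0 < m := lt_of_le_of_lt (Nat.zero_le _) v.2
  have h1 : Fin.divNat ⟨(u : ℕ) * m + v, hlt⟩ = u := by
    ext; simp only [Fin.coe_divNat]; rw [Nat.add_comm, Nat.add_mul_div_right _ _ hm, Nat.div_eq_of_lt v.2, Nat.zero_add]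
  have h2 : Fin.modNat ⟨(u : ℕ) * m + v, hlt⟩ = v := by
    ext; simp only [Fin.coe_modNat]; rw [Nat.add_comm, Nat.add_mul_mod_self_right, Nat.mod_eq_of_lt v.2]
  rw [h1, h2]

/-- **Windows of a row**: `window A (u m + s) L = [G.Adj u (s), …, G.Adj u (s + L - 1)]` inside row `u`. -/
theorem window_adjOf (G : SimpleGraph (Fin m)) (u : Fin m) {s L : ℕ} (h : s + L ≤ m) :
    window (adjOf G) (u * m + s) L = List.ofFn fun c : Fin L => decide (G.Adj u ⟨s + c, by omega⟩) := by
  rw [window_eq_ofFn]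
  congr 1; funext c
  rw [Nat.add_assoc]
  exact getD_adjOf G u ⟨s + c, by omega⟩

/-! ### The parameters on codes -/

/-- The number of free vertices, `g = ⌊log₂ m⌋`. -/
abbrev gg (m : ℕ) : ℕ := Nat.log 2 m

/-- The number of ordered vertices, `n = m - ⌊log₂ m⌋`. -/
abbrev nn (m : ℕ) : ℕ := m - Nat.log 2 m

/-- `n + g = m`. -/
theorem nn_add_gg (m : ℕ) : nn m + gg m = m := Nat.sub_add_cancel (Nat.log_le_self 2 m)

/-- `sndF (code G) = A`. -/
@[simp] theorem sndF_codeOf (G : SimpleGraph (Fin m)) : sndF (codeOf G) = adjOf G := by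
  rw [codeOf_eq, sndF_boolPair]

/-- `unM (code G) = 1ᵐ`. -/
@[simp] theorem unM_codeOf (G : SimpleGraph (Fin m)) : unM (codeOf G) = ones m := by
  rw [codeOf_eq, unM_code (length_adjOf G)]

/-- `unG (code G) = 1ᵍ`. -/
@[simp] theorem unG_codeOf (G : SimpleGraph (Fin m)) : unG (codeOf G) = ones (gg m) := by
  rw [codeOf_eq, unG_code (length_adjOf G)]

/-- `unN (code G) = 1ⁿ`. -/
@[simp] theorem unN_codeOf (G : SimpleGraph (Fin m)) : unN (codeOf G) = ones (nn m) := by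
  rw [codeOf_eq, unN_code (length_adjOf G)]

/-! ### Ordered and free vertices -/

/-- The ordered vertex `i < n`. -/
def org (m : ℕ) (i : Fin (nn m)) : Fin m := ⟨i, lt_of_lt_of_le i.2 (Nat.sub_le _ _)⟩

/-- The free vertex `n + j`, `j < g`. -/
def fre (m : ℕ) (j : Fin (gg m)) : Fin m := ⟨nn m + j, by have := nn_add_gg m; omega⟩

/-- Value of `org`. -/
@[simp] theorem org_val (i : Fin (nn m)) : (org m i : ℕ) = i := rfl

/-- Value of `fre`. -/
@[simp] theorem fre_val (j : Fin (gg m)) : (fre m j : ℕ) = nn m + j := rfl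

/-- `org` is injective. -/
theorem org_injective (m : ℕ) : Function.Injective (org m) := fun i i' h => by
  ext; simpa using congrArg Fin.val h

/-- `fre` is injective. -/
theorem fre_injective (m : ℕ) : Function.Injective (fre m) := fun j j' h => by
  ext; simpa using congrArg Fin.val h

/-- Every vertex is ordered or free. -/
theorem org_or_fre (u : Fin m) : (∃ i, u = org m i) ∨ ∃ j, u = fre m j := by
  by_cases h : (u : ℕ) < nn m
  · exact Or.inl ⟨⟨u, h⟩, by ext; rfl⟩
  · refine Or.inr ⟨⟨u - nn m, ?_⟩, by ext; simp; omega⟩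
    have := nn_add_gg m; have := u.2; omega

/-- An ordered vertex is not free. -/
theorem org_ne_fre (i : Fin (nn m)) (j : Fin (gg m)) : org m i ≠ fre m j := by
  intro h; have := congrArg Fin.val h; simp at this; omega

/-- The budget fixes exactly the ordered vertices: `(org i) + g < m`. -/
theorem org_add_lt (i : Fin (nn m)) : (org m i : ℕ) + gg m < m := by
  have := nn_add_gg m; have := i.2; simp; omega

/-! ### Attachment vectors, fixed block and free graph on codes -/

/-- **The attachment vector on a code**: the adjacencies of free vertex `t` to the ordered vertices. -/
theorem attOf_codeOf (G : SimpleGraph (Fin m)) (t : Fin (gg m)) :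
    attOf (codeOf G) t = List.ofFn fun i : Fin (nn m) => decide (G.Adj (fre m t) (org m i)) := by
  unfold attOf
  rw [sndF_codeOf, unN_codeOf, unM_codeOf]
  simp only [ones, List.length_replicate]
  have h := window_adjOf G (fre m t) (s := 0) (L := nn m) (by have := nn_add_gg m; omega)
  rw [Nat.add_zero] at h
  rw [show (nn m + t) * m = (fre m t : ℕ) * m from rfl, h]
  refine List.ofFn_inj.2 (funext fun i => ?_)
  rw [show (⟨0 + (i : ℕ), by have := i.2; have := nn_add_gg m; omega⟩ : Fin m) = org m i from Fin.ext (by simp)]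

/-- `|attOf (code G) t| = n`. -/
theorem length_attOf_codeOf (G : SimpleGraph (Fin m)) (t : ℕ) : (attOf (codeOf G) t).length = nn m := by
  rw [length_attOf, unN_codeOf]; simp [ones]

/-- Injectivity of `ccat` on families of pieces of one common length. -/
theorem ccat_inj_of_length {p q : ℕ → List Bool} {L : ℕ} : ∀ {k : ℕ}, (∀ t, t < k → (p t).length = L) →
    (∀ t, t < k → (q t).length = L) → ccat p k = ccat q k → ∀ t, t < k → p t = q t
  | 0, _, _, _, t, ht => absurd ht (Nat.not_lt_zero t)
  | k + 1, hp, hq, h, t, ht => by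
    rw [ccat_succ, ccat_succ] at h
    have hl := List.append_inj h (by
      have e := congrArg List.length h
      simp only [List.length_append, hp k (by omega), hq k (by omega)] at e
      omega)
    rcases Nat.lt_succ_iff_lt_or_eq.1 ht with ht' | rfl
    · exact ccat_inj_of_length (fun t ht => hp t (by omega)) (fun t ht => hq t (by omega)) hl.1 t ht'
    · exact hl.2

/-- The fixed block on a code, row by row. -/
theorem fixedFn_codeOf (G : SimpleGraph (Fin m)) :
    fixedFn (codeOf G) = ccat (fun t => if h : t < nn m then
      List.ofFn fun c : Fin (nn m) => decide (G.Adj (org m ⟨t, h⟩) (org m c)) else []) (nn m) := by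
  rw [fixedFn_apply, sndF_codeOf, unN_codeOf, unM_codeOf]
  simp only [ones, List.length_replicate]
  refine ccat_congr fun t ht => ?_
  rw [dif_pos ht]
  have h := window_adjOf G (org m ⟨t, ht⟩) (s := 0) (L := nn m) (by have := nn_add_gg m; omega)
  rw [Nat.add_zero] at h
  rw [show t * m = (org m ⟨t, ht⟩ : ℕ) * m from rfl, h]
  refine List.ofFn_inj.2 (funext fun i => ?_)
  rw [show (⟨0 + (i : ℕ), by have := i.2; have := nn_add_gg m; omega⟩ : Fin m) = org m i from Fin.ext (by simp)]

/-- **The fixed blocks of two codes agree iff the graphs agree on the ordered vertices.** -/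
theorem fixedFn_codeOf_eq_iff (G₁ G₂ : SimpleGraph (Fin m)) :
    fixedFn (codeOf G₁) = fixedFn (codeOf G₂) ↔
      ∀ i i' : Fin (nn m), G₁.Adj (org m i) (org m i') ↔ G₂.Adj (org m i) (org m i') := by
  rw [fixedFn_codeOf, fixedFn_codeOf]
  constructor
  · intro h i i'
    have hl : ∀ (G : SimpleGraph (Fin m)) (t : ℕ), t < nn m → (if h : t < nn m then
        List.ofFn (fun c : Fin (nn m) => decide (G.Adj (org m ⟨t, h⟩) (org m c))) else []).length = nn m := by
      intro G t ht; rw [dif_pos ht, List.length_ofFn]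
    have := ccat_inj_of_length (hl G₁) (hl G₂) h i i.2
    rw [dif_pos i.2, dif_pos i.2] at this
    have := congrFun (List.ofFn_injective this) i'
    simpa using this
  · intro h
    refine ccat_congr fun t ht => ?_
    rw [dif_pos ht, dif_pos ht]
    congr 1; funext c; rw [h]

/-- **The free graph**: `G` induced on the free vertices, relabelled `j ↦ fre j`. -/
abbrev freeG (G : SimpleGraph (Fin m)) : SimpleGraph (Fin (gg m)) := G.comap (fre m)

/-- The adjacency code of a graph on `Fin k`, row by row. -/
theorem adjOf_eq_flatten {k : ℕ} (H : SimpleGraph (Fin k)) :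
    adjOf H = (List.ofFn fun t : Fin k => List.ofFn fun c : Fin k => decide (H.Adj t c)).flatten := by
  rw [adjOf_eq, List.ofFn_mul]
  refine congrArg List.flatten (List.ofFn_inj.2 (funext fun t => List.ofFn_inj.2 (funext fun c => ?_)))
  have hk : 0 < k := lt_of_le_of_lt (Nat.zero_le _) c.2
  have hlt : (t : ℕ) * k + c < k * k :=
    calc (t : ℕ) * k + c < t * k + k := by have := c.2; omega
      _ = (t + 1) * k := by ring
      _ ≤ k * k := Nat.mul_le_mul_right _ t.2
  have h1 : Fin.divNat (⟨(t : ℕ) * k + c, hlt⟩ : Fin (k * k)) = t := by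
    ext; simp only [Fin.coe_divNat]; rw [Nat.add_comm, Nat.add_mul_div_right _ _ hk, Nat.div_eq_of_lt c.2, Nat.zero_add]
  have h2 : Fin.modNat (⟨(t : ℕ) * k + c, hlt⟩ : Fin (k * k)) = c := by
    ext; simp only [Fin.coe_modNat]; rw [Nat.add_comm, Nat.add_mul_mod_self_right, Nat.mod_eq_of_lt c.2]
  rw [h1, h2]

/-- **The free block on a code is the adjacency code of the free graph.** -/
theorem freeFn_codeOf (G : SimpleGraph (Fin m)) : freeFn (codeOf G) = adjOf (freeG G) := by
  rw [freeFn_apply, sndF_codeOf, unN_codeOf, unM_codeOf, unG_codeOf]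
  simp only [ones, List.length_replicate]
  rw [adjOf_eq_flatten (freeG G), KarpChromatic.ccat_eq_flatten_ofFn]
  refine congrArg List.flatten (List.ofFn_inj.2 (funext fun t => ?_))
  have h := window_adjOf G (fre m t) (s := nn m) (L := gg m) (nn_add_gg m).le
  rw [show (nn m + t) * m + nn m = (fre m t : ℕ) * m + nn m from rfl, h]
  rfl

/-- The rank colouring of the free vertices of a code. -/
noncomputable def rkOf (G : SimpleGraph (Fin m)) (j : Fin (gg m)) : ℕ := rankFam (attOf (codeOf G)) (gg m) j

/-- `encList` is the framed code `frames` of `EncodingFrames.lean`. -/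
theorem encList_eq_frames : ∀ l : List (List Bool), encList l = frames l
  | [] => rfl
  | a :: l => by rw [encList_cons, frames_cons_eq_boolPair, encList_eq_frames l]

/-- `List.range` mapped is `List.ofFn`. -/
theorem map_range_eq_ofFn {α : Type} (f : ℕ → α) (k : ℕ) : (List.range k).map f = List.ofFn fun i : Fin k => f i := by
  rw [List.ofFn_eq_map, ← List.map_coe_finRange_eq_range, List.map_map]; rfl

/-- The rank on a code. -/
theorem rankOf_codeOf (G : SimpleGraph (Fin m)) (t : ℕ) : rankOf (codeOf G) t = rankFam (attOf (codeOf G)) (gg m) t := by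
  unfold rankOf; rw [unG_codeOf]; simp only [ones, List.length_replicate]

/-- **The colour list on a code is the `encodingFinVec` code of the rank colouring.** -/
theorem coloursFn_codeOf (G : SimpleGraph (Fin m)) :
    boolPair (ones (gg m)) (coloursFn (codeOf G)) = (encodingFinVec encodingNatBool (gg m)).encode (rkOf G) := by
  rw [coloursFn_apply, unG_codeOf, finVec_encode_eq, ← boolPair_eq, unaryEncodeNat_eq_replicate, encList_eq_frames,
    map_range_eq_ofFn]
  simp only [ones, List.length_replicate, rankOf_codeOf]
  rfl

/-- **The extraction on a code is the code of the rank-coloured free graph**, in the format of the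
canonical-form hypothesis. -/
theorem extractFn_codeOf (G : SimpleGraph (Fin m)) :
    extractFn (codeOf G) = boolPair (encodingGraph.encode ⟨gg m, freeG G⟩)
      ((encodingFinVec encodingNatBool (gg m)).encode (rkOf G)) := by
  rw [extractFn_apply, freeFn_codeOf, ← coloursFn_codeOf, unG_codeOf, encodingGraph_encode]
  simp only [ones, List.length_replicate]

/-- **The dictionary on a code.** -/
theorem dictFn_codeOf (G : SimpleGraph (Fin m)) :
    dictFn (codeOf G) = encList ((List.range (gg m)).map (lookupFam (attOf (codeOf G)) (gg m) (nn m))) := by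
  rw [dictFn_apply, unG_codeOf]
  simp only [ones, List.length_replicate]
  refine congrArg encList (List.map_congr_left fun r _ => ?_)
  unfold lookupOf; rw [unG_codeOf, unN_codeOf]; simp only [ones, List.length_replicate]

/-! ### Budget permutations and permutations of the free block -/

/-- The free vertices as the subtype `{v | n ≤ v}` of `Fin m`. -/
def freEquiv (m : ℕ) : Fin (gg m) ≃ {v : Fin m // nn m ≤ (v : ℕ)} where
  toFun j := ⟨fre m j, Nat.le_add_right _ _⟩
  invFun v := ⟨(v.1 : ℕ) - nn m, by have := v.2; have := v.1.2; have := nn_add_gg m; omega⟩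
  left_inv j := by ext; simp
  right_inv v := by ext; simp only [fre_val]; have := v.2; omega

/-- Value of `freEquiv`. -/
@[simp] theorem freEquiv_apply_val (j : Fin (gg m)) : ((freEquiv m j : {v : Fin m // nn m ≤ (v : ℕ)}) : Fin m) = fre m j := rfl

/-- **A budget permutation fixes the ordered vertices and permutes the free ones.** -/
theorem exists_freePerm (ρ : Equiv.Perm (Fin m)) (hρ : ρ ∈ pointStabiliserBudget m (gg m)) :
    (∀ i, ρ (org m i) = org m i) ∧ ∃ σ : Equiv.Perm (Fin (gg m)), ∀ j, ρ (fre m j) = fre m (σ j) := by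
  rw [mem_pointStabiliserBudget_iff] at hρ
  have horg : ∀ i, ρ (org m i) = org m i := fun i => hρ _ (org_add_lt i)
  refine ⟨horg, ?_⟩
  have hlt : ∀ x : Fin m, (x : ℕ) < nn m → ((ρ x : Fin m) : ℕ) < nn m := fun x hx => by
    rw [hρ x (by have := nn_add_gg m; omega)]; exact hx
  have hp : ∀ x : Fin m, nn m ≤ ((ρ x : Fin m) : ℕ) ↔ nn m ≤ (x : ℕ) := by
    intro x
    constructor
    · intro h; by_contra hx; push Not at hx; exact absurd (hlt x hx) (not_lt.2 h)
    · intro h; by_contra hx; push Not at hx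
      have e : ρ (ρ x) = ρ x := hρ (ρ x) (by have := nn_add_gg m; omega)
      have hfix := ρ.injective e
      rw [hfix] at hx; omega
  let σ : Equiv.Perm (Fin (gg m)) := ((freEquiv m).trans (ρ.subtypePerm hp)).trans (freEquiv m).symm
  refine ⟨σ, fun j => ?_⟩
  have h : (freEquiv m (σ j) : Fin m) = ρ (fre m j) := by
    simp only [σ, Equiv.trans_apply, Equiv.apply_symm_apply, Equiv.Perm.subtypePerm_apply]; rfl
  rw [← h]; rfl

/-- **A permutation of the free block extends by the identity to a budget permutation.** -/
theorem exists_budget_perm (τ : Equiv.Perm (Fin (gg m))) :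
    ∃ ρ ∈ pointStabiliserBudget m (gg m), (∀ i, ρ (org m i) = org m i) ∧ ∀ j, ρ (fre m j) = fre m (τ j) := by
  refine ⟨τ.extendDomain (freEquiv m), ?_, fun i => ?_, fun j => ?_⟩
  · rw [mem_pointStabiliserBudget_iff]
    intro v hv
    exact Equiv.Perm.extendDomain_apply_not_subtype _ _ (by have := nn_add_gg m; simp; omega)
  · exact Equiv.Perm.extendDomain_apply_not_subtype _ _ (by show ¬ nn m ≤ (i : ℕ); have := i.2; omega)
  · exact Equiv.Perm.extendDomain_apply_image τ (freEquiv m) j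

/-- Equal attachment vectors, read as adjacencies. -/
theorem adj_org_iff_of_attOf_eq {G₁ G₂ : SimpleGraph (Fin m)} {j₁ j₂ : Fin (gg m)}
    (h : attOf (codeOf G₂) j₂ = attOf (codeOf G₁) j₁) (i : Fin (nn m)) :
    G₂.Adj (fre m j₂) (org m i) ↔ G₁.Adj (fre m j₁) (org m i) := by
  rw [attOf_codeOf, attOf_codeOf, List.ofFn_inj] at h
  exact decide_eq_decide.1 (congrFun h i)

/-- **(⇐) From a budget permutation carrying `G₁` onto `G₂`**: the ordered blocks agree, and some
permutation `σ` of the free block transports attachment vectors and the free graph. -/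
theorem transfer_of_budget {G₁ G₂ : SimpleGraph (Fin m)} (ρ : Equiv.Perm (Fin m))
    (hρ : ρ ∈ pointStabiliserBudget m (gg m)) (hG : ∀ u v, G₂.Adj u v ↔ G₁.Adj (ρ u) (ρ v)) :
    (∀ i i', G₁.Adj (org m i) (org m i') ↔ G₂.Adj (org m i) (org m i')) ∧
      ∃ σ : Equiv.Perm (Fin (gg m)), (∀ j : Fin (gg m), attOf (codeOf G₂) j = attOf (codeOf G₁) (σ j)) ∧
        ∀ a b, (freeG G₂).Adj a b ↔ (freeG G₁).Adj (σ a) (σ b) := by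
  obtain ⟨horg, σ, hσ⟩ := exists_freePerm ρ hρ
  refine ⟨fun i i' => by rw [hG, horg, horg], σ, fun j => ?_, fun a b => ?_⟩
  · rw [attOf_codeOf, attOf_codeOf]
    refine List.ofFn_inj.2 (funext fun i => decide_eq_decide.2 ?_)
    rw [hG, hσ, horg]
  · rw [SimpleGraph.comap_adj, SimpleGraph.comap_adj, hG, hσ, hσ]

/-- **(⇒) To a budget permutation**: if the ordered blocks agree and a permutation `τ` of the free block
carries the free graph of `G₁` onto that of `G₂` preserving attachment vectors, then some
`ρ ∈ pointStabiliserBudget m g` carries `G₁` onto `G₂`. -/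
theorem budget_of_transfer {G₁ G₂ : SimpleGraph (Fin m)} (τ : Equiv.Perm (Fin (gg m)))
    (hfix : ∀ i i', G₁.Adj (org m i) (org m i') ↔ G₂.Adj (org m i) (org m i'))
    (hatt : ∀ j, attOf (codeOf G₂) (τ j) = attOf (codeOf G₁) j)
    (hiso : ∀ a b, (freeG G₂).Adj (τ a) (τ b) ↔ (freeG G₁).Adj a b) :
    ∃ ρ ∈ pointStabiliserBudget m (gg m), ∀ u v, G₂.Adj u v ↔ G₁.Adj (ρ u) (ρ v) := by
  obtain ⟨ρ, hρ, horg, hfre⟩ := exists_budget_perm (m := m) τ.symm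
  refine ⟨ρ, hρ, ?_⟩
  have hatt' : ∀ j : Fin (gg m), attOf (codeOf G₂) j = attOf (codeOf G₁) (τ.symm j) := fun j => by
    simpa using hatt (τ.symm j)
  have hfo : ∀ j i, G₂.Adj (fre m j) (org m i) ↔ G₁.Adj (ρ (fre m j)) (ρ (org m i)) := fun j i => by
    rw [hfre, horg]; exact adj_org_iff_of_attOf_eq (hatt' j) i
  intro u v
  rcases org_or_fre u with ⟨i, rfl⟩ | ⟨j, rfl⟩ <;> rcases org_or_fre v with ⟨i', rfl⟩ | ⟨j', rfl⟩
  · rw [horg, horg]; exact (hfix i i').symm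
  · rw [G₂.adj_comm, G₁.adj_comm]; exact hfo j' i
  · exact hfo j i'
  · rw [hfre, hfre]
    have := hiso (τ.symm j) (τ.symm j')
    simp only [Equiv.apply_symm_apply, SimpleGraph.comap_adj] at this
    exact this

end Summit.PneNP.PneNP.Theorems.CompleteInvariant

namespace Summit.PneNP.PneNP.Theorems

open Literature.Computability.Complexity CompleteInvariant

/-- **Registered sub-goal of S1b (`stub_completeInvariantFP_extractFn_code`)**: on a graph code the
extraction is the code of the rank-coloured free graph, in the input format of the canonical-form
hypothesis (brick file `SymmetryBudgetWindowBarrierGraphBridge`). -/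
theorem stub_completeInvariantFP_extractFn_code : ∀ (m : ℕ) (G : SimpleGraph (Fin m)), extractFn (encodingGraph.encode ⟨m, G⟩) = boolPair (encodingGraph.encode ⟨gg m, freeG G⟩) ((encodingFinVec Computability.encodingNatBool (gg m)).encode (rkOf G)) :=
  fun _ G => extractFn_codeOf G

end Summit.PneNP.PneNP.Theorems
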